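import Summits.MatrixMultiplication.MatrixMultiplication.Theorems.SaturationLadderTwinMember
import HarnessLib

/-!
# SaturationLadder — uniform ceilings are preserved by convex hulls (abstract form + twin instance)

Route `SaturationLadder` (sub-problem `MatrixMultiplication`), crux `SubexpSaturation`
(stmt-MatrixMultiplication-25909), ladder `Base(θ)`.  A family `P` of certified saturating pairs `(t, r)`
(`ω(1,t,r) ≤ 1 + r`) has UNIFORM CEILING `c` if `t ≤ 1`, `r ≥ 0` on `P` and, for every `ε > 0`, all members
with `t` close enough to `1` satisfy `(1 − t)·log r ≥ c − ε`.  Since saturating pairs form a convex set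
(Lotti–Romani), the certificates really available to a prover are the convex HULL of the families in the
tree.  This file proves, abstractly and once and for all:

* `hull_uniform_ceiling`: the finite convex hull of a family with uniform ceiling `c > 0` again has uniform
  ceiling `c` (Markov's inequality on the weights; no Jensen);
* `no_base_of_uniform_ceiling`: a family with uniform ceiling `c > log θ` cannot certify `Base(θ)`, even
  through convex combinations;
* `twin_uniform_ceiling`: the STAGE-2 twin class (`SaturationLadderTwinExact.omegaRect_one_tw_exact`,
  hypotheses verbatim) has uniform ceiling `c₂ = (5 log(5/4) + 3 log 2)/3 = log θ_c`, `θ_c = (3125/128)^{1/3}`;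
* `no_subcritical_base_mixed`: consequently, for `θ³ < 3125/128`, no convex combination of twin-class members
  AND members of ANY other family with uniform ceiling `≥ c₂` certifies `Base(θ)` — mixing certificate
  classes never lowers the ceiling below the best class constant.

This is the class-independent form of the method barrier recorded by `SaturationLadderTwinHullNoBase`:
a new certificate class must beat `θ_c` on its own.  No definitions, no named facts, no sorry.
[cite: LottiRomani1983, §1 (p. 173)] [cite: CoppersmithWinograd1990, §8]
[cite: AlmanDuanVassilevskaWilliamsXuXuZhou2025, §3.4]
-/

set_option linter.dupNamespace false
-- (single-conjunct summit: the namespace repeats `MatrixMultiplication`)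

noncomputable section

namespace Summit.MatrixMultiplication.MatrixMultiplication.Theorems.SaturationLadderHullCeiling

open Literature.Computability.AlgebraicComplexity
open Summit.MatrixMultiplication.MatrixMultiplication.Theorems.SaturationLadderTwinClassNoBase
  (three_log_lt_of_cube_lt)
open Summit.MatrixMultiplication.MatrixMultiplication.Theorems.SaturationLadderTwinMember
  (member_t_le_one member_mass member_ceiling member_r_pos)

/-! ### §1  Convex hulls keep uniform ceilings -/

/-- **Hull closure of a uniform ceiling.**  If every member `(t, r)` of `P` has `t ≤ 1`, `r ≥ 0`, and members
with `t → 1` satisfy `(1 − t) log r ≥ c − ε` uniformly, then so do finite convex combinations of members.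
[cite: LottiRomani1983, §1 (p. 173)] -/
theorem hull_uniform_ceiling {c : ℝ} (hc : 0 < c) (P : ℝ → ℝ → Prop)
    (hP0 : ∀ t r, P t r → t ≤ 1 ∧ 0 ≤ r)
    (hP : ∀ ε : ℝ, 0 < ε → ∃ τ : ℝ, τ < 1 ∧
      ∀ t r, P t r → τ ≤ t → 0 < r ∧ c - ε ≤ (1 - t) * Real.log r)
    (ε : ℝ) (hε : 0 < ε) :
    ∃ τ : ℝ, τ < 1 ∧ ∀ (m : ℕ) (w t r : Fin m → ℝ), (∀ i, 0 ≤ w i) → ∑ i, w i = 1 →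
      (∀ i, P (t i) (r i)) → τ ≤ ∑ i, w i * t i →
      0 < ∑ i, w i * r i ∧ c - ε ≤ (1 - ∑ i, w i * t i) * Real.log (∑ i, w i * r i) := by
  classical
  -- constants
  set ε' : ℝ := min ε (c / 2) with hε'def
  have hε'0 : 0 < ε' := lt_min hε (by positivity)
  have hε'ε : ε' ≤ ε := min_le_left _ _
  have hε'c : ε' ≤ c / 2 := min_le_right _ _
  obtain ⟨τ₁, hτ₁, hP₁⟩ := hP (ε' / 4) (by positivity)
  set η : ℝ := ε' / (4 * c) with hηdef
  have hη0 : 0 < η := by positivity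
  have hηc : η * c = ε' / 4 := by rw [hηdef]; field_simp
  set c' : ℝ := c - ε' / 4 with hc'def
  have hc'0 : 0 < c' := by rw [hc'def]; linarith
  set lam : ℝ := η / (1 + η) with hlamdef
  have hlam0 : 0 < lam := by positivity
  have hlam1 : lam ≤ 1 := by rw [hlamdef, div_le_one (by positivity)]; linarith
  set L : ℝ := - Real.log lam with hLdef
  have hL0 : 0 ≤ L := by rw [hLdef]; linarith [Real.log_nonpos hlam0.le hlam1]
  set τ : ℝ := max (1 - (1 - τ₁) / (1 + η)) (1 - ε' / (2 * (L + 1))) with hτdef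
  have hτ1 : τ < 1 := by
    have a : 0 < (1 - τ₁) / (1 + η) := by apply div_pos <;> linarith
    have b : 0 < ε' / (2 * (L + 1)) := by positivity
    exact max_lt (by linarith) (by linarith)
  refine ⟨τ, hτ1, ?_⟩
  intro m w t r hw hsum hPi hτt
  have hτa : 1 - (1 - τ₁) / (1 + η) ≤ ∑ i, w i * t i := (le_max_left _ _).trans hτt
  have hτb : 1 - ε' / (2 * (L + 1)) ≤ ∑ i, w i * t i := (le_max_right _ _).trans hτt
  -- per-member facts
  have hT1 : ∀ i, t i ≤ 1 := fun i => (hP0 _ _ (hPi i)).1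
  have hR0 : ∀ i, 0 ≤ r i := fun i => (hP0 _ _ (hPi i)).2
  have h1T0 : ∀ i, τ₁ ≤ t i → 0 < 1 - t i := by
    intro i hi
    obtain ⟨-, h2⟩ := hP₁ _ _ (hPi i) hi
    rcases le_or_gt (1 - t i) 0 with h | h
    · have h0 : 1 - t i = 0 := le_antisymm h (by linarith [hT1 i])
      rw [h0, zero_mul] at h2; linarith
    · exact h
  -- `δ = 1 - Σ wᵢ tᵢ` is positive
  have e1T : ∑ i, w i * (1 - t i) = 1 - ∑ i, w i * t i := by
    simp only [mul_sub, mul_one, Finset.sum_sub_distrib, hsum]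
  set δ : ℝ := 1 - ∑ i, w i * t i with hδdef
  have hδ0 : 0 < δ := by
    rcases le_or_gt δ 0 with h | h
    · exfalso
      have hnn : ∀ i ∈ Finset.univ, 0 ≤ w i * (1 - t i) :=
        fun i _ => mul_nonneg (hw i) (by linarith [hT1 i])
      have hz : ∑ i, w i * (1 - t i) = 0 := le_antisymm (by rw [e1T]; exact h) (Finset.sum_nonneg hnn)
      have hall : ∀ i, w i = 0 := by
        intro i
        rcases mul_eq_zero.mp ((Finset.sum_eq_zero_iff_of_nonneg hnn).mp hz i (Finset.mem_univ i))
          with h' | h'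
        · exact h'
        · exfalso
          have := h1T0 i (by linarith [hτ₁])
          linarith
      simp [hall] at hsum
    · exact h
  -- good members: `1 - tᵢ ≤ (1+η) δ`
  have hgoodfact : ∀ i, 1 - t i ≤ (1 + η) * δ → Real.exp (c' / ((1 + η) * δ)) ≤ r i := by
    intro i hi
    have hti : τ₁ ≤ t i := by
      have : (1 + η) * δ ≤ 1 - τ₁ := by
        rw [hδdef]
        have := mul_le_mul_of_nonneg_left (show 1 - ∑ i, w i * t i ≤ (1 - τ₁) / (1 + η) by
          linarith [hτa]) (show (0 : ℝ) ≤ 1 + η by linarith)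
        rwa [mul_div_cancel₀ _ (by positivity : (1 : ℝ) + η ≠ 0)] at this
      linarith
    obtain ⟨hri, hci⟩ := hP₁ _ _ (hPi i) hti
    have h1 := h1T0 i hti
    have hlogR : c' / (1 - t i) ≤ Real.log (r i) := by
      rw [div_le_iff₀ h1]; linarith only [hci]
    have hlogR' : c' / ((1 + η) * δ) ≤ Real.log (r i) :=
      (div_le_div_of_nonneg_left hc'0.le h1 hi).trans hlogR
    calc Real.exp (c' / ((1 + η) * δ)) ≤ Real.exp (Real.log (r i)) := Real.exp_le_exp.mpr hlogR'
      _ = r i := Real.exp_log hri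
  -- Markov: the good members carry weight at least `η/(1+η)`
  set good := Finset.univ.filter (fun i => 1 - t i ≤ (1 + η) * δ) with hgood_def
  set bad := Finset.univ.filter (fun i => ¬ (1 - t i ≤ (1 + η) * δ)) with hbad_def
  have hsplit : ∑ i ∈ good, w i + ∑ i ∈ bad, w i = 1 := by
    rw [hgood_def, hbad_def, Finset.sum_filter_add_sum_filter_not]; exact hsum
  have hbad1 : (∑ i ∈ bad, w i) * ((1 + η) * δ) ≤ δ := by
    rw [Finset.sum_mul]
    calc ∑ i ∈ bad, w i * ((1 + η) * δ) ≤ ∑ i ∈ bad, w i * (1 - t i) :=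
          Finset.sum_le_sum (fun i hi =>
            mul_le_mul_of_nonneg_left (le_of_lt (not_le.mp (Finset.mem_filter.mp hi).2)) (hw i))
      _ ≤ ∑ i, w i * (1 - t i) :=
          Finset.sum_le_sum_of_subset_of_nonneg (Finset.filter_subset _ _)
            (fun i _ _ => mul_nonneg (hw i) (by linarith only [hT1 i]))
      _ = δ := e1T
  have hbad2 : (∑ i ∈ bad, w i) * (1 + η) ≤ 1 := by
    have h' : (∑ i ∈ bad, w i) * (1 + η) * δ ≤ 1 * δ := by rw [one_mul, mul_assoc]; exact hbad1
    exact le_of_mul_le_mul_right h' hδ0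
  have hgoodw : lam ≤ ∑ i ∈ good, w i := by
    have e : ∑ i ∈ good, w i = 1 - ∑ i ∈ bad, w i := by linarith only [hsplit]
    rw [e, hlamdef, div_le_iff₀ (by positivity)]
    nlinarith only [hbad2, hη0]
  -- lower bound on the hull ordinate
  have hE0 : 0 < Real.exp (c' / ((1 + η) * δ)) := Real.exp_pos _
  have hsum_good : (∑ i ∈ good, w i) * Real.exp (c' / ((1 + η) * δ)) ≤ ∑ i, w i * r i := by
    rw [Finset.sum_mul]
    calc ∑ i ∈ good, w i * Real.exp (c' / ((1 + η) * δ)) ≤ ∑ i ∈ good, w i * r i :=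
          Finset.sum_le_sum (fun i hi =>
            mul_le_mul_of_nonneg_left (hgoodfact i (Finset.mem_filter.mp hi).2) (hw i))
      _ ≤ ∑ i, w i * r i :=
          Finset.sum_le_sum_of_subset_of_nonneg (Finset.filter_subset _ _)
            (fun i _ _ => mul_nonneg (hw i) (hR0 i))
  have hlow : lam * Real.exp (c' / ((1 + η) * δ)) ≤ ∑ i, w i * r i :=
    (mul_le_mul_of_nonneg_right hgoodw hE0.le).trans hsum_good
  have hpos : 0 < ∑ i, w i * r i := lt_of_lt_of_le (mul_pos hlam0 hE0) hlow
  refine ⟨hpos, ?_⟩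
  have hlog_low : Real.log lam + c' / ((1 + η) * δ) ≤ Real.log (∑ i, w i * r i) := by
    have := Real.log_le_log (mul_pos hlam0 hE0) hlow
    rwa [Real.log_mul hlam0.ne' hE0.ne', Real.log_exp] at this
  have hmul := mul_le_mul_of_nonneg_left hlog_low hδ0.le
  have e1 : δ * (Real.log lam + c' / ((1 + η) * δ)) = -(δ * L) + c' / (1 + η) := by
    rw [mul_add, mul_div_assoc', mul_comm (1 + η) δ, mul_div_mul_left _ _ hδ0.ne', hLdef]; ring
  rw [e1] at hmul
  have hcη : c - ε' / 2 ≤ c' / (1 + η) := by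
    rw [le_div_iff₀ (by positivity), hc'def]
    have := mul_nonneg hε'0.le hη0.le
    linarith only [hηc, this]
  have hδL : δ * L ≤ ε' / 2 := by
    have hδle : δ ≤ ε' / (2 * (L + 1)) := by rw [hδdef]; linarith only [hτb]
    calc δ * L ≤ δ * (L + 1) := by nlinarith only [hδ0, hL0]
      _ ≤ ε' / (2 * (L + 1)) * (L + 1) := mul_le_mul_of_nonneg_right hδle (by linarith)
      _ = ε' / 2 := by field_simp
  linarith only [hmul, hcη, hδL, hε'ε]

/-! ### §2  A uniform ceiling above `log θ` excludes `Base(θ)` -/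

/-- No family with uniform ceiling `c > log θ` certifies `Base(θ)` through convex combinations.
[cite: LottiRomani1983, §1 (p. 173)] -/
theorem no_base_of_uniform_ceiling {c θ C : ℝ} (hθ : 1 < θ) (hθc : Real.log θ < c)
    (P : ℝ → ℝ → Prop) (hP0 : ∀ t r, P t r → t ≤ 1 ∧ 0 ≤ r)
    (hP : ∀ ε : ℝ, 0 < ε → ∃ τ : ℝ, τ < 1 ∧
      ∀ t r, P t r → τ ≤ t → 0 < r ∧ c - ε ≤ (1 - t) * Real.log r)
    (H : ∀ s : ℝ, 0 ≤ s → s < 1 → ∃ (m : ℕ) (w t r : Fin m → ℝ), (∀ i, 0 ≤ w i) ∧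
      ∑ i, w i = 1 ∧ (∀ i, P (t i) (r i)) ∧ s ≤ ∑ i, w i * t i ∧
      ∑ i, w i * r i ≤ C * θ ^ (1 / (1 - s))) : False := by
  have hθ0 : 0 < θ := by linarith
  have hlogθ : 0 < Real.log θ := Real.log_pos hθ
  have hc : 0 < c := by linarith
  set g : ℝ := c - Real.log θ with hgdef
  have hg : 0 < g := by rw [hgdef]; linarith
  obtain ⟨τ, hτ1, hτ⟩ := hull_uniform_ceiling hc P hP0 hP (g / 2) (by positivity)
  set C' : ℝ := max C 1 with hC'def
  have hC'1 : 1 ≤ C' := le_max_right _ _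
  have hC'0 : 0 < C' := by linarith
  have hlogC' : 0 ≤ Real.log C' := Real.log_nonneg hC'1
  set s₁ : ℝ := 1 - g / (4 * (Real.log C' + 1)) with hs₁def
  have hs₁ : s₁ < 1 := by
    have : 0 < g / (4 * (Real.log C' + 1)) := by positivity
    rw [hs₁def]; linarith
  set s : ℝ := max 0 (max τ s₁) with hsdef
  have hs0 : 0 ≤ s := le_max_left _ _
  have hs1 : s < 1 := max_lt (by norm_num) (max_lt hτ1 hs₁)
  obtain ⟨m, w, t, r, hw, hsum, hPi, hst, hr⟩ := H s hs0 hs1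
  have hτt : τ ≤ ∑ i, w i * t i := ((le_max_left _ _).trans (le_max_right _ _)).trans hst
  have hs₁t : s₁ ≤ ∑ i, w i * t i := ((le_max_right _ _).trans (le_max_right _ _)).trans hst
  obtain ⟨hpos, hceil⟩ := hτ m w t r hw hsum hPi hτt
  -- `δ = 1 - Σ wᵢ tᵢ` is positive and at most `1 - s`
  have htb1 : ∑ i, w i * t i ≤ 1 := by
    calc ∑ i, w i * t i ≤ ∑ i, w i * 1 :=
          Finset.sum_le_sum (fun i _ => mul_le_mul_of_nonneg_left (hP0 _ _ (hPi i)).1 (hw i))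
      _ = 1 := by simp [hsum]
  have hδ0 : 0 < 1 - ∑ i, w i * t i := by
    rcases le_or_gt (1 - ∑ i, w i * t i) 0 with h | h
    · have h0 : 1 - ∑ i, w i * t i = 0 := le_antisymm h (by linarith)
      rw [h0, zero_mul] at hceil; linarith
    · exact h
  -- the upper bound
  have hr' : ∑ i, w i * r i ≤ C' * θ ^ (1 / (1 - s)) :=
    hr.trans (mul_le_mul_of_nonneg_right (le_max_left _ _) (Real.rpow_nonneg hθ0.le _))
  have hlog_up : Real.log (∑ i, w i * r i) ≤ Real.log C' + 1 / (1 - s) * Real.log θ := by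
    have := Real.log_le_log hpos hr'
    rwa [Real.log_mul hC'0.ne' (Real.rpow_pos_of_pos hθ0 _).ne', Real.log_rpow hθ0] at this
  have hmul := mul_le_mul_of_nonneg_left hlog_up hδ0.le
  have hq : (1 - ∑ i, w i * t i) * (1 / (1 - s) * Real.log θ) ≤ Real.log θ := by
    rw [← mul_assoc, mul_one_div]
    have : (1 - ∑ i, w i * t i) / (1 - s) ≤ 1 := by
      rw [div_le_one (by linarith)]; linarith
    have := mul_le_mul_of_nonneg_right this hlogθ.le
    linarith
  have hq' : (1 - ∑ i, w i * t i) * Real.log C' ≤ (1 - s₁) * Real.log C' :=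
    mul_le_mul_of_nonneg_right (by linarith) hlogC'
  have hq'' : (1 - s₁) * Real.log C' ≤ g / 4 := by
    rw [hs₁def, sub_sub_cancel, div_mul_eq_mul_div, div_le_div_iff₀ (by positivity) (by positivity)]
    have := mul_nonneg hg.le hlogC'
    linarith
  have : c - g / 2 ≤ g / 4 + Real.log θ := by
    calc c - g / 2 ≤ (1 - ∑ i, w i * t i) * Real.log (∑ i, w i * r i) := hceil
      _ ≤ (1 - ∑ i, w i * t i) * (Real.log C' + 1 / (1 - s) * Real.log θ) := hmul
      _ = (1 - ∑ i, w i * t i) * Real.log C' +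
            (1 - ∑ i, w i * t i) * (1 / (1 - s) * Real.log θ) := by ring
      _ ≤ g / 4 + Real.log θ := by linarith
  rw [hgdef] at this
  linarith

/-! ### §3  The twin class has uniform ceiling `c₂`, and mixing it with other classes does not help -/

/-- The STAGE-2 twin class has uniform ceiling `c₂ = (5 log(5/4) + 3 log 2)/3`: for every `ε > 0`, every
member with `t ≥ 1 − min(1/80, ε/6400)` has `r > 0` and `(1 − t) log r ≥ c₂ − ε`.
[cite: CoppersmithWinograd1990, §8] [cite: AlmanDuanVassilevskaWilliamsXuXuZhou2025, §3.4] -/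
theorem twin_uniform_ceiling (ε : ℝ) (hε : 0 < ε) : ∃ τ : ℝ, τ < 1 ∧
    ∀ (j n₁ n₂ n₃ n₄ n₅ n₆ : ℕ), 0 < n₆ → n₁ + n₄ + n₅ = 2 * n₆ → n₂ + n₃ = 2 ^ (j + 1) * n₆ →
      shannonEntropy ![((n₁ : ℝ) + n₄ + n₅) / (n₁ + n₂ + n₃ + n₄ + n₅ + n₆ : ℕ),
            ((n₂ : ℝ) + n₃) / (n₁ + n₂ + n₃ + n₄ + n₅ + n₆ : ℕ),
            (n₆ : ℝ) / (n₁ + n₂ + n₃ + n₄ + n₅ + n₆ : ℕ)] ≤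
          shannonEntropy ![((n₂ : ℝ) + n₄ + n₆) / (n₁ + n₂ + n₃ + n₄ + n₅ + n₆ : ℕ),
            ((n₁ : ℝ) + n₃) / (n₁ + n₂ + n₃ + n₄ + n₅ + n₆ : ℕ),
            (n₅ : ℝ) / (n₁ + n₂ + n₃ + n₄ + n₅ + n₆ : ℕ)] →
      shannonEntropy ![((n₁ : ℝ) + n₄ + n₅) / (n₁ + n₂ + n₃ + n₄ + n₅ + n₆ : ℕ),
            ((n₂ : ℝ) + n₃) / (n₁ + n₂ + n₃ + n₄ + n₅ + n₆ : ℕ),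
            (n₆ : ℝ) / (n₁ + n₂ + n₃ + n₄ + n₅ + n₆ : ℕ)] ≤
          shannonEntropy ![((n₃ : ℝ) + n₅ + n₆) / (n₁ + n₂ + n₃ + n₄ + n₅ + n₆ : ℕ),
            ((n₁ : ℝ) + n₂) / (n₁ + n₂ + n₃ + n₄ + n₅ + n₆ : ℕ),
            (n₄ : ℝ) / (n₁ + n₂ + n₃ + n₄ + n₅ + n₆ : ℕ)] →
      τ ≤ (j : ℝ) * n₁ / (((j : ℝ) + 1) * n₃ + n₅) →
      0 < (((j : ℝ) + 1) * n₂ + n₁ + n₄) / (((j : ℝ) + 1) * n₃ + n₅) ∧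
        (5 * Real.log (5 / 4) + 3 * Real.log 2) / 3 - ε ≤
          (1 - (j : ℝ) * n₁ / (((j : ℝ) + 1) * n₃ + n₅)) *
            Real.log ((((j : ℝ) + 1) * n₂ + n₁ + n₄) / (((j : ℝ) + 1) * n₃ + n₅)) := by
  set δ₀ : ℝ := min (1 / 80) (ε / 6400) with hδ₀def
  have hδ₀0 : 0 < δ₀ := lt_min (by norm_num) (by positivity)
  have hδ₀a : δ₀ ≤ 1 / 80 := min_le_left _ _
  have hδ₀b : δ₀ ≤ ε / 6400 := min_le_right _ _
  refine ⟨1 - δ₀, by linarith, ?_⟩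
  intro j n₁ n₂ n₃ n₄ n₅ n₆ hn₆ hz₁ hz₂ hX hY hτ
  have hJ0 : (0 : ℝ) < (j : ℝ) + 1 := by positivity
  have ht : 1 / 2 ≤ (j : ℝ) * n₁ / (((j : ℝ) + 1) * n₃ + n₅) := by linarith
  have hTm := member_mass j n₁ n₂ n₃ n₄ n₅ n₆ hn₆ hz₁ hz₂ hX hY ht
  have h1t : 1 - (j : ℝ) * n₁ / (((j : ℝ) + 1) * n₃ + n₅) ≤ δ₀ := by linarith
  have h16 : 1 ≤ 16 * δ₀ * ((j : ℝ) + 1) := by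
    have := mul_le_mul_of_nonneg_right h1t hJ0.le
    linarith only [hTm, this]
  have hJ4 : (4 : ℝ) ≤ (j : ℝ) + 1 := by
    rcases le_or_gt 4 ((j : ℝ) + 1) with h | h
    · exact h
    · have := mul_lt_mul_of_pos_left h (show 0 < 16 * δ₀ by positivity)
      linarith only [h16, this, hδ₀a]
  have hj3 : 3 ≤ j := by
    have : (3 : ℝ) ≤ (j : ℝ) := by linarith only [hJ4]
    exact_mod_cast this
  have h320 : 320 / ((j : ℝ) + 1) ≤ ε := by
    rw [div_le_iff₀ hJ0]
    have := mul_le_mul_of_nonneg_right (show 5120 * δ₀ ≤ ε by linarith only [hδ₀b, hε]) hJ0.le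
    linarith only [h16, this]
  have hC2 := member_ceiling j n₁ n₂ n₃ n₄ n₅ n₆ hj3 hn₆ hz₁ hz₂ hX hY ht
  exact ⟨member_r_pos j n₁ n₂ n₃ n₄ n₅ ht, by linarith only [hC2, h320]⟩

/-- **Mixed hulls.**  For `1 < θ`, `θ³ < 3125/128`: no convex combination of STAGE-2 twin-class members and of
members of ANY family `Q` with uniform ceiling `≥ c₂` certifies `Base(θ)`.  (With `Q = ⊥` this is
`SaturationLadderTwinHullNoBase.no_subcritical_base_hull`.)
[cite: LottiRomani1983, §1 (p. 173)] [cite: CoppersmithWinograd1990, §8]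
[cite: AlmanDuanVassilevskaWilliamsXuXuZhou2025, §3.4] -/
theorem no_subcritical_base_mixed {θ C : ℝ} (hθ : 1 < θ) (hθc : θ ^ 3 < (3125 : ℝ) / 128)
    (Q : ℝ → ℝ → Prop) (hQ0 : ∀ t r, Q t r → t ≤ 1 ∧ 0 ≤ r)
    (hQ : ∀ ε : ℝ, 0 < ε → ∃ τ : ℝ, τ < 1 ∧ ∀ t r, Q t r → τ ≤ t →
      0 < r ∧ (5 * Real.log (5 / 4) + 3 * Real.log 2) / 3 - ε ≤ (1 - t) * Real.log r)
    (H : ∀ s : ℝ, 0 ≤ s → s < 1 → ∃ (m : ℕ) (w t r : Fin m → ℝ), (∀ i, 0 ≤ w i) ∧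
      ∑ i, w i = 1 ∧
      (∀ i, Q (t i) (r i) ∨ ∃ (j n₁ n₂ n₃ n₄ n₅ n₆ : ℕ), 0 < n₆ ∧ n₁ + n₄ + n₅ = 2 * n₆ ∧
        n₂ + n₃ = 2 ^ (j + 1) * n₆ ∧
        shannonEntropy ![((n₁ : ℝ) + n₄ + n₅) / (n₁ + n₂ + n₃ + n₄ + n₅ + n₆ : ℕ),
              ((n₂ : ℝ) + n₃) / (n₁ + n₂ + n₃ + n₄ + n₅ + n₆ : ℕ),
              (n₆ : ℝ) / (n₁ + n₂ + n₃ + n₄ + n₅ + n₆ : ℕ)] ≤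
            shannonEntropy ![((n₂ : ℝ) + n₄ + n₆) / (n₁ + n₂ + n₃ + n₄ + n₅ + n₆ : ℕ),
              ((n₁ : ℝ) + n₃) / (n₁ + n₂ + n₃ + n₄ + n₅ + n₆ : ℕ),
              (n₅ : ℝ) / (n₁ + n₂ + n₃ + n₄ + n₅ + n₆ : ℕ)] ∧
        shannonEntropy ![((n₁ : ℝ) + n₄ + n₅) / (n₁ + n₂ + n₃ + n₄ + n₅ + n₆ : ℕ),
              ((n₂ : ℝ) + n₃) / (n₁ + n₂ + n₃ + n₄ + n₅ + n₆ : ℕ),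
              (n₆ : ℝ) / (n₁ + n₂ + n₃ + n₄ + n₅ + n₆ : ℕ)] ≤
            shannonEntropy ![((n₃ : ℝ) + n₅ + n₆) / (n₁ + n₂ + n₃ + n₄ + n₅ + n₆ : ℕ),
              ((n₁ : ℝ) + n₂) / (n₁ + n₂ + n₃ + n₄ + n₅ + n₆ : ℕ),
              (n₄ : ℝ) / (n₁ + n₂ + n₃ + n₄ + n₅ + n₆ : ℕ)] ∧
        t i = (j : ℝ) * n₁ / (((j : ℝ) + 1) * n₃ + n₅) ∧
        r i = (((j : ℝ) + 1) * n₂ + n₁ + n₄) / (((j : ℝ) + 1) * n₃ + n₅)) ∧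
      s ≤ ∑ i, w i * t i ∧ ∑ i, w i * r i ≤ C * θ ^ (1 / (1 - s))) : False := by
  have hθ0 : 0 < θ := by linarith
  have hθc' : Real.log θ < (5 * Real.log (5 / 4) + 3 * Real.log 2) / 3 := by
    have := three_log_lt_of_cube_lt hθ0 hθc; linarith
  -- the mixed family
  refine no_base_of_uniform_ceiling hθ hθc'
    (fun t r => Q t r ∨ ∃ (j n₁ n₂ n₃ n₄ n₅ n₆ : ℕ), 0 < n₆ ∧ n₁ + n₄ + n₅ = 2 * n₆ ∧
        n₂ + n₃ = 2 ^ (j + 1) * n₆ ∧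
        shannonEntropy ![((n₁ : ℝ) + n₄ + n₅) / (n₁ + n₂ + n₃ + n₄ + n₅ + n₆ : ℕ),
              ((n₂ : ℝ) + n₃) / (n₁ + n₂ + n₃ + n₄ + n₅ + n₆ : ℕ),
              (n₆ : ℝ) / (n₁ + n₂ + n₃ + n₄ + n₅ + n₆ : ℕ)] ≤
            shannonEntropy ![((n₂ : ℝ) + n₄ + n₆) / (n₁ + n₂ + n₃ + n₄ + n₅ + n₆ : ℕ),
              ((n₁ : ℝ) + n₃) / (n₁ + n₂ + n₃ + n₄ + n₅ + n₆ : ℕ),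
              (n₅ : ℝ) / (n₁ + n₂ + n₃ + n₄ + n₅ + n₆ : ℕ)] ∧
        shannonEntropy ![((n₁ : ℝ) + n₄ + n₅) / (n₁ + n₂ + n₃ + n₄ + n₅ + n₆ : ℕ),
              ((n₂ : ℝ) + n₃) / (n₁ + n₂ + n₃ + n₄ + n₅ + n₆ : ℕ),
              (n₆ : ℝ) / (n₁ + n₂ + n₃ + n₄ + n₅ + n₆ : ℕ)] ≤
            shannonEntropy ![((n₃ : ℝ) + n₅ + n₆) / (n₁ + n₂ + n₃ + n₄ + n₅ + n₆ : ℕ),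
              ((n₁ : ℝ) + n₂) / (n₁ + n₂ + n₃ + n₄ + n₅ + n₆ : ℕ),
              (n₄ : ℝ) / (n₁ + n₂ + n₃ + n₄ + n₅ + n₆ : ℕ)] ∧
        t = (j : ℝ) * n₁ / (((j : ℝ) + 1) * n₃ + n₅) ∧
        r = (((j : ℝ) + 1) * n₂ + n₁ + n₄) / (((j : ℝ) + 1) * n₃ + n₅))
    ?_ ?_ H
  · rintro t r (hq | ⟨j, n₁, n₂, n₃, n₄, n₅, n₆, hn₆, hz₁, hz₂, hX, hY, rfl, rfl⟩)
    · exact hQ0 t r hq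
    · exact ⟨member_t_le_one j n₁ n₂ n₃ n₄ n₅ n₆ hn₆ hz₁ hz₂ hX hY, by positivity⟩
  · intro ε hε
    obtain ⟨τ₁, hτ₁, h₁⟩ := hQ ε hε
    obtain ⟨τ₂, hτ₂, h₂⟩ := twin_uniform_ceiling ε hε
    refine ⟨max τ₁ τ₂, max_lt hτ₁ hτ₂, ?_⟩
    rintro t r (hq | ⟨j, n₁, n₂, n₃, n₄, n₅, n₆, hn₆, hz₁, hz₂, hX, hY, rfl, rfl⟩) hτ
    · exact h₁ t r hq ((le_max_left _ _).trans hτ)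
    · exact h₂ j n₁ n₂ n₃ n₄ n₅ n₆ hn₆ hz₁ hz₂ hX hY ((le_max_right _ _).trans hτ)

end Summit.MatrixMultiplication.MatrixMultiplication.Theorems.SaturationLadderHullCeiling
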